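/-
Origin: expansion seat `prover-pub-hodgecm-mc-carch-1-g37-0`, handover #CA69 2026-08-21T03:18Z md5 12ea8f145969 (491 l.; NEW additive leaf; imports Model.ArchKTypeOfDist + Model.ArchKTypeOfTorus + Model.ArchLineDatumOf + Model.ArchTypeReadOff; ns HodgeCM.Model.ArchSideTerm; 33 theorems 9 data defs; NAMES for audit: HodgeCM.Model.ArchSideTerm.w_mul_lineCharV_zero_eq_torusScalar · HodgeCM.Model.ArchSideTerm.cmArchCenter_eq_archSectionFrameOf_mul_centerAway · HodgeCM.Model.ArchSideTerm.weightOf_blockK_centralK) (`HOME/mc/pub-hodgecm-mc-carch-1/stage71/HodgeCM/Model/ArchKTypeOfCentralWeight.lean`, md5 12ea8f145969, 491 lines);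
landed by the gen-30 packager (p-g30) in gate run 71 as `HodgeCM/Model/ArchKTypeOfCentralWeight.lean` (verbatim).
-/
/-
Copyright (c) 2026. Released under Apache 2.0 license as described in the file LICENSE.
Cell pub-hodgecm, MODEL layer (construction prover mc-carch-1, gen 37), row-9 (J-Liu-Θ) junction, the ONE archimedean identity per slot
behind the automorphy of the slot dictionary characters (sinst-1-g11 SEAM NOTE 2026-08-21 (Hw_k); #1260/#1261 `isAutChar_…_of_weight`).
-/
import Summits.HodgeConjecture.HodgeCM.Model.ArchKTypeOfDist
import Summits.HodgeConjecture.HodgeCM.Model.ArchKTypeOfTorus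
import Summits.HodgeConjecture.HodgeCM.Model.ArchLineDatumOf_3
import Summits.HodgeConjecture.HodgeCM.Model.ArchTypeReadOff

/-!
# The archimedean weight of a line pin against its torus scalar: `w_k · s_k(centre) = torusScalar_k`

For the honest S-side line representation `lineRepOf V S hGR hGR₀ hGR₁ hGR₂ hGR₃ η₀ η₁ η₂ η₃ k` (LAYER B `Model/ArchSideTerm`; ANY four
`η`'s — period-1's `archSideOf` (`lineRepD`, default split) and the pin of record `archSideOfT'` (`lineRepT'`, `SROGT'C`) alike,
`archSideOf_P_ω` ∕ `archSideOfT'_P_ω` are `rfl`) and ANY archimedean input `A : ArchLineInput V (lineRepOf … k)` (period-1 §A: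
`Φinf, x₀, hx₀, w, weight`), split the scalar of line `k` into

* its `V`-part **`lineCharV_k := (η_k ∘ inl) · (χ_k ∘ inl) : U(diag frameD V)(𝔸) →* ℂˣ`** (§ 1; `k = 0`: sinst-1's `adelicCharZero`
  VERBATIM at `η₀ := eta₀ V c.D η`; `k = 1` in the default split: trivial, #CA21; at the ν-twisted pins `lineCharV_one … (etaT₁ η ν) = ν`),
* its `W`-part at the centre, the torus scalar `torusScalar_kG … η_k : U(1)(𝔸_{L⁺}) →* ℂˣ` (#CA60).

§ 2 (**the identity, generic**).  The `weight` field of `A` (the `U(W_k)`-torus `(1, (t,1_f))` acts on `φ_N(Φ_∞)` by `w t`), the centre swap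
`lineRepOf_k_one_center` (`(1,(t,1_f)) ↦ torusScalar_k(u_t) • ω_k(u_t·1_V, 1)`) and the nonvanishing of `φ_N` give, for every `t ∈ U(1)(L⁺ ⊗ ℝ)`:

  **(Hw_k′) `w t · lineCharV_k (u_t · 1_V) = torusScalar_k (u_t)`  ⟺  (CF_k) `lineCharV_k (u_t·1_V) • ω_k(u_t·1_V, 1) φ_N(Φ_∞) = φ_N(Φ_∞)`**

(`u_t = (cmAdelicOneEquivRelNormOne L).symm (relNormOneInfToIdeles t)`; (CF_k) says: the archimedean CENTRE in the `U(V)`-SLOT of the TWISTED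
line kernel fixes the pinned vector — `lineRepOf_k_apply_one` reads the `U(V)`-slot as `lineCharV_k(v) • ω_k(v, 1)`).  (CF_k) is false for a
generic `A` and true for the honest harmonic datum (§ 3).

§ 3 (**the centre split**, for the dischargers).  § 3a: the central elements `centralK z = (z·1₂, z)` of `K = U(2) × U(1)`,
`blockU (centralK z) = z · 1₃`, and **`τ₁(z·1) = id`** (`weightOf_blockK_centralK`, `weightOf_dual_blockK_centralK`: the Jacobian of a scalar on the
ball is the identity).  § 3b: the `w(ι₁)`-coordinate `centerCoord t` of `t ∈ U(1)(L⁺ ⊗ ℝ)`, `|·| = 1`, and `centerUnit t := embTwist (centerCoord t) ∈ U(1)`.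
§ 3c: **`cmArchCenter (diag frameD V) t = archSectionFrameOf V (centerK t) · centerAway V t`** with `archAt w(ι₁) (centerAway V t) = 1`
(components: #CA6 `coe_archAt_archSectionFrameOf_cmPlace'`, tree `coe_archCenter`, `embTwist_embTwist`), and `(t · 1₃)^𝔸 = u_t · 1_V`
(tree `archToAdelic_cmArchCenter`).  The discharge of (CF_k) for the honest harmonic datum — away factor by (c5), `ι₁`-section factor by `harm` at the
central `centerK t` — and the composed (Hw_k′) are `Model/ArchKTypeOfCentralWeightPin` (slots 0, 1) and `Model/ArchKTypeOfCentralWeightPin34` (slots 2, 3).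

Nothing is cited and nothing is minted: kernel lemmas over installed modules; 0 records, 0 `def … : Prop` (four `MonoidHom` data defs).
-/

set_option autoImplicit false

noncomputable section

open NumberField NumberField.InfinitePlace NumberField.mixedEmbedding IsDedekindDomain
open scoped Matrix TensorProduct Classical SchwartzMap
open MulAction
open Literature.Geometry.ComplexHyperbolic.BallModel (U21 x₀ stabilizerEquivK21 blockK blockU bmat mat_blockU)
open Literature.NumberTheory.Automorphic.U21 (K21 matA sclD)
open Literature.AlgebraicGeometry.ShimuraVarieties Literature.AlgebraicGeometry.ShimuraVarieties.BallForms
open Literature.NumberTheory.Automorphic Literature.NumberTheory.Automorphic.UnitaryGroup Literature.NumberTheory.Weil1964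
open Literature.RepresentationTheory.KonnoKonno2007 Literature.RepresentationTheory.KonnoKonno2007.RealDualPair
open Literature.NumberTheory.GelbartRogawski1991 Literature.NumberTheory.GelbartRogawski1991.UnitaryDualPair
open Literature.Analysis.SegalBargmann
open HodgeCM.Adelic HodgeCM.PerL34 HodgeCM.Model.HypCensus HodgeCM.Model.SupplyInstance

namespace HodgeCM.Model.ArchSideTerm

variable {L : CMField} {ι₁ : L →+* ℂ} (V : HermSpace3 L ι₁) (S : StubTree.SeesawDatum L)
variable
  (hGR : (cmSplittingDatum (L : Type) finProdFinEquiv (frameD V) (frameD_real V) (frameD_ne V) (dW S) (dW_real S) (dW_ne S)).CompatibleSplitting)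
  (hGR₀ : (cmSplittingDatum (L : Type) (e₁) (frameD V) (frameD_real V) (frameD_ne V) (lineVec (L : Type) (dW S 0))
    (fun _ => dW_real S 0) (fun _ => dW_ne S 0)).CompatibleSplitting)
  (hGR₁ : (cmSplittingDatum (L : Type) (e₁) (frameD V) (frameD_real V) (frameD_ne V) (lineVec (L : Type) (dW S 1))
    (fun _ => dW_real S 1) (fun _ => dW_ne S 1)).CompatibleSplitting)
  (hGR₂ : (cmSplittingDatum (L : Type) (e₁) (frameD V) (frameD_real V) (frameD_ne V) (lineVec (L : Type) (dW' S 0))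
    (fun _ => dW'_real S 0) (fun _ => dW'_ne S 0)).CompatibleSplitting)
  (hGR₃ : (cmSplittingDatum (L : Type) (e₁) (frameD V) (frameD_real V) (frameD_ne V) (lineVec (L : Type) (dW' S 1))
    (fun _ => dW'_real S 1) (fun _ => dW'_ne S 1)).CompatibleSplitting)
  (η₀ η₁ η₂ η₃ : CMAdelic (L : Type) (frameD V) × CMAdelicOne (L : Type) →* ℂˣ)

/-! ### § 1. The `V`-parts of the four line scalars -/

/-- **the `V`-part of the line-0 scalar**: `v ↦ η₀(v, 1) · χ₀(v, 1)` (sinst-1's `adelicCharZero` at `η₀ := eta₀ V c.D η`). -/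
def lineCharV_zero : CMAdelic (L : Type) (frameD V) →* ℂˣ :=
  η₀.comp (MonoidHom.inl _ _) *
    (cmLineChar₀ (L : Type) finProdFinEquiv e₁ (frameD V) (frameD_real V) (frameD_ne V) (dW S) (dW_real S) (dW_ne S) hGR hGR₀ hGR₁).comp
      (MonoidHom.inl _ _)

/-- **the `V`-part of the line-1 scalar**: `v ↦ η₁(v, 1) · χ₁(v, 1)`. -/
def lineCharV_one : CMAdelic (L : Type) (frameD V) →* ℂˣ :=
  η₁.comp (MonoidHom.inl _ _) *
    (cmLineChar₁ (L : Type) finProdFinEquiv e₁ (frameD V) (frameD_real V) (frameD_ne V) (dW S) (dW_real S) (dW_ne S) hGR hGR₀ hGR₁).comp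
      (MonoidHom.inl _ _)

/-- **the `V`-part of the line-2 scalar** (conjugated plane): `v ↦ η₂(v, 1) · χ′₀(v, 1)`. -/
def lineCharV_two : CMAdelic (L : Type) (frameD V) →* ℂˣ :=
  η₂.comp (MonoidHom.inl _ _) *
    (cmConjLineChar₀ (L : Type) finProdFinEquiv e₁ (frameD V) (frameD_real V) (frameD_ne V) (dW S) (dW_real S) (dW_ne S)
        (dW' S) (dW'_real S) (dW'_ne S) S.isoGL (isoGL_hg₀ S) hGR hGR₂ hGR₃).comp (MonoidHom.inl _ _)

/-- **the `V`-part of the line-3 scalar** (conjugated plane): `v ↦ η₃(v, 1) · χ′₁(v, 1)`. -/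
def lineCharV_three : CMAdelic (L : Type) (frameD V) →* ℂˣ :=
  η₃.comp (MonoidHom.inl _ _) *
    (cmConjLineChar₁ (L : Type) finProdFinEquiv e₁ (frameD V) (frameD_real V) (frameD_ne V) (dW S) (dW_real S) (dW_ne S)
        (dW' S) (dW'_real S) (dW'_ne S) S.isoGL (isoGL_hg₀ S) hGR hGR₂ hGR₃).comp (MonoidHom.inl _ _)

/-- (Ported verbatim from the HodgeCMPerL package; no docstring in the source.) -/
theorem lineCharV_zero_apply (v : CMAdelic (L : Type) (frameD V)) :
    lineCharV_zero V S hGR hGR₀ hGR₁ η₀ v =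
      η₀ (v, 1) * cmLineChar₀ (L : Type) finProdFinEquiv e₁ (frameD V) (frameD_real V) (frameD_ne V) (dW S) (dW_real S) (dW_ne S)
        hGR hGR₀ hGR₁ (v, 1) := rfl

/-- (Ported verbatim from the HodgeCMPerL package; no docstring in the source.) -/
theorem lineCharV_one_apply (v : CMAdelic (L : Type) (frameD V)) :
    lineCharV_one V S hGR hGR₀ hGR₁ η₁ v =
      η₁ (v, 1) * cmLineChar₁ (L : Type) finProdFinEquiv e₁ (frameD V) (frameD_real V) (frameD_ne V) (dW S) (dW_real S) (dW_ne S)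
        hGR hGR₀ hGR₁ (v, 1) := rfl

/-- (Ported verbatim from the HodgeCMPerL package; no docstring in the source.) -/
theorem lineCharV_two_apply (v : CMAdelic (L : Type) (frameD V)) :
    lineCharV_two V S hGR hGR₂ hGR₃ η₂ v =
      η₂ (v, 1) * cmConjLineChar₀ (L : Type) finProdFinEquiv e₁ (frameD V) (frameD_real V) (frameD_ne V) (dW S) (dW_real S) (dW_ne S)
        (dW' S) (dW'_real S) (dW'_ne S) S.isoGL (isoGL_hg₀ S) hGR hGR₂ hGR₃ (v, 1) := rfl

/-- (Ported verbatim from the HodgeCMPerL package; no docstring in the source.) -/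
theorem lineCharV_three_apply (v : CMAdelic (L : Type) (frameD V)) :
    lineCharV_three V S hGR hGR₂ hGR₃ η₃ v =
      η₃ (v, 1) * cmConjLineChar₁ (L : Type) finProdFinEquiv e₁ (frameD V) (frameD_real V) (frameD_ne V) (dW S) (dW_real S) (dW_ne S)
        (dW' S) (dW'_real S) (dW'_ne S) S.isoGL (isoGL_hg₀ S) hGR hGR₂ hGR₃ (v, 1) := rfl

/-- the line-0 scalar on archimedean elements (#CA27 `archScalar_zeroG`) is `lineCharV_zero ∘ archToAdelic`. -/
theorem archScalar_zeroG_eq_lineCharV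
    (x : UnitaryGroup.arch (↥(maximalRealSubfield L)) L (IsCMField.complexConj L) 3 (Matrix.diagonal (frameD V))) :
    archScalar_zeroG V S hGR hGR₀ hGR₁ η₀ x =
      lineCharV_zero V S hGR hGR₀ hGR₁ η₀
        (UnitaryGroup.archToAdelic (↥(maximalRealSubfield L)) L (IsCMField.complexConj L) 3 (Matrix.diagonal (frameD V)) x) := rfl

/-- the line-1 scalar on archimedean elements (#CA27 `archScalar_oneG`) is `lineCharV_one ∘ archToAdelic`. -/
theorem archScalar_oneG_eq_lineCharV
    (x : UnitaryGroup.arch (↥(maximalRealSubfield L)) L (IsCMField.complexConj L) 3 (Matrix.diagonal (frameD V))) :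
    archScalar_oneG V S hGR hGR₀ hGR₁ η₁ x =
      lineCharV_one V S hGR hGR₀ hGR₁ η₁
        (UnitaryGroup.archToAdelic (↥(maximalRealSubfield L)) L (IsCMField.complexConj L) 3 (Matrix.diagonal (frameD V)) x) := rfl

/-- the line-0 scalar along the `ι₁`-section (#CA3 `lineScalar_zero`) is `lineCharV_zero` at `(archSectionFrameOf V u)^𝔸`. -/
theorem lineScalar_zero_eq_lineCharV (u : U21) :
    lineScalar_zero V S hGR hGR₀ hGR₁ η₀ u =
      lineCharV_zero V S hGR hGR₀ hGR₁ η₀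
        (UnitaryGroup.archToAdelic (↥(maximalRealSubfield L)) L (IsCMField.complexConj L) 3 (Matrix.diagonal (frameD V))
          (archSectionFrameOf V u)) := rfl

/-- the line-1 scalar along the `ι₁`-section (#CA3 `lineScalar_one`) is `lineCharV_one` at `(archSectionFrameOf V u)^𝔸`. -/
theorem lineScalar_one_eq_lineCharV (u : U21) :
    lineScalar_one V S hGR hGR₀ hGR₁ η₁ u =
      lineCharV_one V S hGR hGR₀ hGR₁ η₁
        (UnitaryGroup.archToAdelic (↥(maximalRealSubfield L)) L (IsCMField.complexConj L) 3 (Matrix.diagonal (frameD V))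
          (archSectionFrameOf V u)) := rfl

/-! ### § 1b. The `U(V)`-slot of the four line kernels: `lineRepOf k (g, 1) = lineCharV_k(v_g) • ω_k(v_g, 1)` -/

/-- **the `U(V)`-slot of line 0**: `lineRepOf 0 (g, 1) φ = lineCharV_0(v) • cmPairRep e₁ hGR₀ (v, 1) φ`, `v = cmFrameEquiv g`. -/
theorem lineRepOf_zero_apply_one (g : ↥(regimeSubgroup L V.Hm)) (φ : piSchwartzBruhat (↥(maximalRealSubfield L)) (Fin 3)) :
    lineRepOf V S hGR hGR₀ hGR₁ hGR₂ hGR₃ η₀ η₁ η₂ η₃ 0 (g, 1) φ =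
      ((lineCharV_zero V S hGR hGR₀ hGR₁ η₀
          (cmFrameEquiv (L : Type) (frameG V) V.Hm (frameD V) (frame_congr V) (g : ↥(HodgeCM.Adelic.adelicUnitaryGroup (L : Type) V.Hm))) : ℂˣ) : ℂ) •
        cmPairRep (L : Type) e₁ (frameD V) (frameD_real V) (frameD_ne V) (lineVec (L : Type) (dW S 0)) (fun _ => dW_real S 0)
          (fun _ => dW_ne S 0) hGR₀
          (cmFrameEquiv (L : Type) (frameG V) V.Hm (frameD V) (frame_congr V) (g : ↥(HodgeCM.Adelic.adelicUnitaryGroup (L : Type) V.Hm)), 1) φ := by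
  have h := cmLineRepFin₀_apply_eq_smul_cmPairRep (L : Type) finProdFinEquiv e₁ (frameD V) (frameD_real V) (frameD_ne V)
    (dW S) (dW_real S) (dW_ne S) hGR hGR₀ hGR₁ η₀
    (cmFrameEquiv (L : Type) (frameG V) V.Hm (frameD V) (frame_congr V) (g : ↥(HodgeCM.Adelic.adelicUnitaryGroup (L : Type) V.Hm))) 1 φ
  rw [map_one, map_one] at h
  exact h

/-- **the `U(V)`-slot of line 1.** -/
theorem lineRepOf_one_apply_one (g : ↥(regimeSubgroup L V.Hm)) (φ : piSchwartzBruhat (↥(maximalRealSubfield L)) (Fin 3)) :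
    lineRepOf V S hGR hGR₀ hGR₁ hGR₂ hGR₃ η₀ η₁ η₂ η₃ 1 (g, 1) φ =
      ((lineCharV_one V S hGR hGR₀ hGR₁ η₁
          (cmFrameEquiv (L : Type) (frameG V) V.Hm (frameD V) (frame_congr V) (g : ↥(HodgeCM.Adelic.adelicUnitaryGroup (L : Type) V.Hm))) : ℂˣ) : ℂ) •
        cmPairRep (L : Type) e₁ (frameD V) (frameD_real V) (frameD_ne V) (lineVec (L : Type) (dW S 1)) (fun _ => dW_real S 1)
          (fun _ => dW_ne S 1) hGR₁
          (cmFrameEquiv (L : Type) (frameG V) V.Hm (frameD V) (frame_congr V) (g : ↥(HodgeCM.Adelic.adelicUnitaryGroup (L : Type) V.Hm)), 1) φ := by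
  have h := cmLineRepFin₁_apply_eq_smul_cmPairRep (L : Type) finProdFinEquiv e₁ (frameD V) (frameD_real V) (frameD_ne V)
    (dW S) (dW_real S) (dW_ne S) hGR hGR₀ hGR₁ η₁
    (cmFrameEquiv (L : Type) (frameG V) V.Hm (frameD V) (frame_congr V) (g : ↥(HodgeCM.Adelic.adelicUnitaryGroup (L : Type) V.Hm))) 1 φ
  rw [map_one, map_one] at h
  exact h

/-- **the `U(V)`-slot of line 2.** -/
theorem lineRepOf_two_apply_one (g : ↥(regimeSubgroup L V.Hm)) (φ : piSchwartzBruhat (↥(maximalRealSubfield L)) (Fin 3)) :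
    lineRepOf V S hGR hGR₀ hGR₁ hGR₂ hGR₃ η₀ η₁ η₂ η₃ 2 (g, 1) φ =
      ((lineCharV_two V S hGR hGR₂ hGR₃ η₂
          (cmFrameEquiv (L : Type) (frameG V) V.Hm (frameD V) (frame_congr V) (g : ↥(HodgeCM.Adelic.adelicUnitaryGroup (L : Type) V.Hm))) : ℂˣ) : ℂ) •
        cmPairRep (L : Type) e₁ (frameD V) (frameD_real V) (frameD_ne V) (lineVec (L : Type) (dW' S 0)) (fun _ => dW'_real S 0)
          (fun _ => dW'_ne S 0) hGR₂
          (cmFrameEquiv (L : Type) (frameG V) V.Hm (frameD V) (frame_congr V) (g : ↥(HodgeCM.Adelic.adelicUnitaryGroup (L : Type) V.Hm)), 1) φ := by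
  have h := cmConjLineRepFin₀_apply_eq_smul_cmPairRep (L : Type) finProdFinEquiv e₁ (frameD V) (frameD_real V) (frameD_ne V)
    (dW S) (dW_real S) (dW_ne S) (dW' S) (dW'_real S) (dW'_ne S) S.isoGL (isoGL_hg₀ S) hGR hGR₂ hGR₃ η₂
    (cmFrameEquiv (L : Type) (frameG V) V.Hm (frameD V) (frame_congr V) (g : ↥(HodgeCM.Adelic.adelicUnitaryGroup (L : Type) V.Hm))) 1 φ
  rw [map_one, map_one] at h
  exact h

/-- **the `U(V)`-slot of line 3.** -/
theorem lineRepOf_three_apply_one (g : ↥(regimeSubgroup L V.Hm)) (φ : piSchwartzBruhat (↥(maximalRealSubfield L)) (Fin 3)) :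
    lineRepOf V S hGR hGR₀ hGR₁ hGR₂ hGR₃ η₀ η₁ η₂ η₃ 3 (g, 1) φ =
      ((lineCharV_three V S hGR hGR₂ hGR₃ η₃
          (cmFrameEquiv (L : Type) (frameG V) V.Hm (frameD V) (frame_congr V) (g : ↥(HodgeCM.Adelic.adelicUnitaryGroup (L : Type) V.Hm))) : ℂˣ) : ℂ) •
        cmPairRep (L : Type) e₁ (frameD V) (frameD_real V) (frameD_ne V) (lineVec (L : Type) (dW' S 1)) (fun _ => dW'_real S 1)
          (fun _ => dW'_ne S 1) hGR₃
          (cmFrameEquiv (L : Type) (frameG V) V.Hm (frameD V) (frame_congr V) (g : ↥(HodgeCM.Adelic.adelicUnitaryGroup (L : Type) V.Hm)), 1) φ := by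
  have h := cmConjLineRepFin₁_apply_eq_smul_cmPairRep (L : Type) finProdFinEquiv e₁ (frameD V) (frameD_real V) (frameD_ne V)
    (dW S) (dW_real S) (dW_ne S) (dW' S) (dW'_real S) (dW'_ne S) S.isoGL (isoGL_hg₀ S) hGR hGR₂ hGR₃ η₃
    (cmFrameEquiv (L : Type) (frameG V) V.Hm (frameD V) (frame_congr V) (g : ↥(HodgeCM.Adelic.adelicUnitaryGroup (L : Type) V.Hm))) 1 φ
  rw [map_one, map_one] at h
  exact h

/-! ### § 2. The identity, generic: (CF_k) ⟹ (Hw_k′) -/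

section Generic

/-- cancelling a nonzero vector: `a • x = b • x → a = b`. -/
theorem smul_cancel_of_ne_zero {X : Type*} [AddCommGroup X] [Module ℂ X] {x : X} (hx : x ≠ 0) {a b : ℂ}
    (h : a • x = b • x) : a = b := by
  by_contra hab
  have h2 : (a - b) • x = 0 := by rw [sub_smul, h, sub_self]
  rcases smul_eq_zero.mp h2 with h3 | h3
  · exact hab (sub_eq_zero.mp h3)
  · exact hx h3

/-- the algebra of § 2: from `τ • P = w • φ` (weight + centre swap), `s • P = φ` ((CF)) and `φ ≠ 0`: `w · s = τ`. -/
private theorem weight_algebra {X : Type*} [AddCommGroup X] [Module ℂ X] {φ P : X} (hφ : φ ≠ 0) {w : ℂ} {τ s : ℂˣ}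
    (hw : ((τ : ℂˣ) : ℂ) • P = w • φ) (hs : ((s : ℂˣ) : ℂ) • P = φ) : w * s = τ := by
  have hP : P = ((s⁻¹ : ℂˣ) : ℂ) • φ := by
    rw [← hs, smul_smul, ← Units.val_mul, inv_mul_cancel, Units.val_one, one_smul]
  rw [hP, smul_smul, ← Units.val_mul] at hw
  have h := smul_cancel_of_ne_zero hφ hw
  rw [← h, Units.val_mul, mul_assoc, ← Units.val_mul, inv_mul_cancel, Units.val_one, mul_one]

/-- **(Hw₀′) from (CF₀)**: if the archimedean centre in the `U(V)`-slot of line 0 fixes `φ_N(Φ_∞)` (at one level `N ≠ 0`), then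
`w t · lineCharV_0 (u_t · 1_V) = torusScalar_0 (u_t)` — for ANY archimedean input `A` of `lineRepOf … 0`. -/
theorem w_mul_lineCharV_zero_eq_torusScalar (A : ArchLineInput V (lineRepOf V S hGR hGR₀ hGR₁ hGR₂ hGR₃ η₀ η₁ η₂ η₃ 0))
    (t : ↥(Literature.NumberTheory.Automorphic.relNormOneInfUnits (↥(maximalRealSubfield L)) L)) {N : ℕ} (hN : N ≠ 0)
    (hfix : ((lineCharV_zero V S hGR hGR₀ hGR₁ η₀ (CMCenter (L : Type) (frameD V)
          ((UnitaryGroup.cmAdelicOneEquivRelNormOne (L : Type)).symm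
            (Literature.NumberTheory.Automorphic.relNormOneInfToIdeles (↥(maximalRealSubfield L)) L t))) : ℂˣ) : ℂ) •
        cmPairRep (L : Type) e₁ (frameD V) (frameD_real V) (frameD_ne V) (lineVec (L : Type) (dW S 0)) (fun _ => dW_real S 0)
          (fun _ => dW_ne S 0) hGR₀
          (CMCenter (L : Type) (frameD V) ((UnitaryGroup.cmAdelicOneEquivRelNormOne (L : Type)).symm
            (Literature.NumberTheory.Automorphic.relNormOneInfToIdeles (↥(maximalRealSubfield L)) L t)), 1)
          (SupplyInstance.testFun (↥(maximalRealSubfield L)) (Fin 3) A.Φinf A.x₀ N) =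
      SupplyInstance.testFun (↥(maximalRealSubfield L)) (Fin 3) A.Φinf A.x₀ N) :
    A.w t * ((lineCharV_zero V S hGR hGR₀ hGR₁ η₀ (CMCenter (L : Type) (frameD V)
          ((UnitaryGroup.cmAdelicOneEquivRelNormOne (L : Type)).symm
            (Literature.NumberTheory.Automorphic.relNormOneInfToIdeles (↥(maximalRealSubfield L)) L t))) : ℂˣ) : ℂ) =
      ((torusScalar_zeroG V S hGR hGR₀ hGR₁ η₀ ((UnitaryGroup.cmAdelicOneEquivRelNormOne (L : Type)).symm
            (Literature.NumberTheory.Automorphic.relNormOneInfToIdeles (↥(maximalRealSubfield L)) L t)) : ℂˣ) : ℂ) := by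
  have hw := A.weight N t
  rw [lineRepOf_zero_one_center] at hw
  exact weight_algebra (testFun_ne_zero A.Φinf A.hx₀ hN) hw hfix

/-- **(Hw₁′) from (CF₁).** -/
theorem w_mul_lineCharV_one_eq_torusScalar (A : ArchLineInput V (lineRepOf V S hGR hGR₀ hGR₁ hGR₂ hGR₃ η₀ η₁ η₂ η₃ 1))
    (t : ↥(Literature.NumberTheory.Automorphic.relNormOneInfUnits (↥(maximalRealSubfield L)) L)) {N : ℕ} (hN : N ≠ 0)
    (hfix : ((lineCharV_one V S hGR hGR₀ hGR₁ η₁ (CMCenter (L : Type) (frameD V)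
          ((UnitaryGroup.cmAdelicOneEquivRelNormOne (L : Type)).symm
            (Literature.NumberTheory.Automorphic.relNormOneInfToIdeles (↥(maximalRealSubfield L)) L t))) : ℂˣ) : ℂ) •
        cmPairRep (L : Type) e₁ (frameD V) (frameD_real V) (frameD_ne V) (lineVec (L : Type) (dW S 1)) (fun _ => dW_real S 1)
          (fun _ => dW_ne S 1) hGR₁
          (CMCenter (L : Type) (frameD V) ((UnitaryGroup.cmAdelicOneEquivRelNormOne (L : Type)).symm
            (Literature.NumberTheory.Automorphic.relNormOneInfToIdeles (↥(maximalRealSubfield L)) L t)), 1)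
          (SupplyInstance.testFun (↥(maximalRealSubfield L)) (Fin 3) A.Φinf A.x₀ N) =
      SupplyInstance.testFun (↥(maximalRealSubfield L)) (Fin 3) A.Φinf A.x₀ N) :
    A.w t * ((lineCharV_one V S hGR hGR₀ hGR₁ η₁ (CMCenter (L : Type) (frameD V)
          ((UnitaryGroup.cmAdelicOneEquivRelNormOne (L : Type)).symm
            (Literature.NumberTheory.Automorphic.relNormOneInfToIdeles (↥(maximalRealSubfield L)) L t))) : ℂˣ) : ℂ) =
      ((torusScalar_oneG V S hGR hGR₀ hGR₁ η₁ ((UnitaryGroup.cmAdelicOneEquivRelNormOne (L : Type)).symm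
            (Literature.NumberTheory.Automorphic.relNormOneInfToIdeles (↥(maximalRealSubfield L)) L t)) : ℂˣ) : ℂ) := by
  have hw := A.weight N t
  rw [lineRepOf_one_one_center] at hw
  exact weight_algebra (testFun_ne_zero A.Φinf A.hx₀ hN) hw hfix

/-- **(Hw₂′) from (CF₂)** (conjugated plane, line 2). -/
theorem w_mul_lineCharV_two_eq_torusScalar (A : ArchLineInput V (lineRepOf V S hGR hGR₀ hGR₁ hGR₂ hGR₃ η₀ η₁ η₂ η₃ 2))
    (t : ↥(Literature.NumberTheory.Automorphic.relNormOneInfUnits (↥(maximalRealSubfield L)) L)) {N : ℕ} (hN : N ≠ 0)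
    (hfix : ((lineCharV_two V S hGR hGR₂ hGR₃ η₂ (CMCenter (L : Type) (frameD V)
          ((UnitaryGroup.cmAdelicOneEquivRelNormOne (L : Type)).symm
            (Literature.NumberTheory.Automorphic.relNormOneInfToIdeles (↥(maximalRealSubfield L)) L t))) : ℂˣ) : ℂ) •
        cmPairRep (L : Type) e₁ (frameD V) (frameD_real V) (frameD_ne V) (lineVec (L : Type) (dW' S 0)) (fun _ => dW'_real S 0)
          (fun _ => dW'_ne S 0) hGR₂
          (CMCenter (L : Type) (frameD V) ((UnitaryGroup.cmAdelicOneEquivRelNormOne (L : Type)).symm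
            (Literature.NumberTheory.Automorphic.relNormOneInfToIdeles (↥(maximalRealSubfield L)) L t)), 1)
          (SupplyInstance.testFun (↥(maximalRealSubfield L)) (Fin 3) A.Φinf A.x₀ N) =
      SupplyInstance.testFun (↥(maximalRealSubfield L)) (Fin 3) A.Φinf A.x₀ N) :
    A.w t * ((lineCharV_two V S hGR hGR₂ hGR₃ η₂ (CMCenter (L : Type) (frameD V)
          ((UnitaryGroup.cmAdelicOneEquivRelNormOne (L : Type)).symm
            (Literature.NumberTheory.Automorphic.relNormOneInfToIdeles (↥(maximalRealSubfield L)) L t))) : ℂˣ) : ℂ) =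
      ((torusScalar_twoG V S hGR hGR₂ hGR₃ η₂ ((UnitaryGroup.cmAdelicOneEquivRelNormOne (L : Type)).symm
            (Literature.NumberTheory.Automorphic.relNormOneInfToIdeles (↥(maximalRealSubfield L)) L t)) : ℂˣ) : ℂ) := by
  have hw := A.weight N t
  rw [lineRepOf_two_one_center] at hw
  exact weight_algebra (testFun_ne_zero A.Φinf A.hx₀ hN) hw hfix

/-- **(Hw₃′) from (CF₃)** (conjugated plane, line 3). -/
theorem w_mul_lineCharV_three_eq_torusScalar (A : ArchLineInput V (lineRepOf V S hGR hGR₀ hGR₁ hGR₂ hGR₃ η₀ η₁ η₂ η₃ 3))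
    (t : ↥(Literature.NumberTheory.Automorphic.relNormOneInfUnits (↥(maximalRealSubfield L)) L)) {N : ℕ} (hN : N ≠ 0)
    (hfix : ((lineCharV_three V S hGR hGR₂ hGR₃ η₃ (CMCenter (L : Type) (frameD V)
          ((UnitaryGroup.cmAdelicOneEquivRelNormOne (L : Type)).symm
            (Literature.NumberTheory.Automorphic.relNormOneInfToIdeles (↥(maximalRealSubfield L)) L t))) : ℂˣ) : ℂ) •
        cmPairRep (L : Type) e₁ (frameD V) (frameD_real V) (frameD_ne V) (lineVec (L : Type) (dW' S 1)) (fun _ => dW'_real S 1)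
          (fun _ => dW'_ne S 1) hGR₃
          (CMCenter (L : Type) (frameD V) ((UnitaryGroup.cmAdelicOneEquivRelNormOne (L : Type)).symm
            (Literature.NumberTheory.Automorphic.relNormOneInfToIdeles (↥(maximalRealSubfield L)) L t)), 1)
          (SupplyInstance.testFun (↥(maximalRealSubfield L)) (Fin 3) A.Φinf A.x₀ N) =
      SupplyInstance.testFun (↥(maximalRealSubfield L)) (Fin 3) A.Φinf A.x₀ N) :
    A.w t * ((lineCharV_three V S hGR hGR₂ hGR₃ η₃ (CMCenter (L : Type) (frameD V)
          ((UnitaryGroup.cmAdelicOneEquivRelNormOne (L : Type)).symm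
            (Literature.NumberTheory.Automorphic.relNormOneInfToIdeles (↥(maximalRealSubfield L)) L t))) : ℂˣ) : ℂ) =
      ((torusScalar_threeG V S hGR hGR₂ hGR₃ η₃ ((UnitaryGroup.cmAdelicOneEquivRelNormOne (L : Type)).symm
            (Literature.NumberTheory.Automorphic.relNormOneInfToIdeles (↥(maximalRealSubfield L)) L t)) : ℂˣ) : ℂ) := by
  have hw := A.weight N t
  rw [lineRepOf_three_one_center] at hw
  exact weight_algebra (testFun_ne_zero A.Φinf A.hx₀ hN) hw hfix

end Generic

/-! ### § 3. (CF_k) for the honest harmonic datum -/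

/-! #### § 3a. The central elements of `K = U(2) × U(1)` and their weight -/

section CentralK

/-- **the central element `(z · 1₂, z)` of `K = U(2) × U(1)`**, `z ∈ U(1)`. -/
def centralK (z : unitary ℂ) : K21 :=
  (⟨(z : ℂ) • (1 : Matrix (Fin 2) (Fin 2) ℂ), by
      rw [Matrix.mem_unitaryGroup_iff, Matrix.star_eq_conjTranspose, Matrix.conjTranspose_smul, Matrix.conjTranspose_one,
        Matrix.smul_mul, Matrix.mul_smul, Matrix.mul_one, smul_smul, Unitary.mul_star_self_of_mem z.2, one_smul]⟩, z)

/-- (Ported verbatim from the HodgeCMPerL package; no docstring in the source.) -/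
@[simp] theorem matA_centralK (z : unitary ℂ) : matA (centralK z) = (z : ℂ) • (1 : Matrix (Fin 2) (Fin 2) ℂ) := rfl

/-- (Ported verbatim from the HodgeCMPerL package; no docstring in the source.) -/
@[simp] theorem sclD_centralK (z : unitary ℂ) : sclD (centralK z) = (z : ℂ) := rfl

/-- `diag(z·1₂, z) = z · 1₃`. -/
theorem bmat_centralK (z : unitary ℂ) : bmat (matA (centralK z)) (sclD (centralK z)) = (z : ℂ) • (1 : Matrix (Fin 3) (Fin 3) ℂ) := by
  ext i j
  fin_cases i <;> fin_cases j <;> simp [bmat]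

/-- **`blockU (z·1₂, z) = z · 1₃` in `U(2,1)`.** -/
theorem coe_blockU_centralK (z : unitary ℂ) :
    (((blockU (centralK z) : U21) : GL (Fin 3) ℂ) : Matrix (Fin 3) (Fin 3) ℂ) = (z : ℂ) • (1 : Matrix (Fin 3) (Fin 3) ℂ) := by
  rw [← bmat_centralK, ← mat_blockU]

/-- **`τ₁(z · 1) = id`**: a central element of `K` acts trivially on the cotangent space at the origin (the Jacobian of a scalar on the
ball is the identity: `pMinus (z·1₂, z) c = z · z̄ · c`). -/
theorem weightOf_blockK_centralK (z : unitary ℂ) : isPullbackCocycle_cotangentCocycle.weightOf x₀ (blockK (centralK z)) = 1 := by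
  apply LinearMap.ext
  intro c
  rw [weightOf_cotangent_blockK, Literature.NumberTheory.Automorphic.U21.pMinus_apply, matA_centralK, sclD_centralK,
    Matrix.conjTranspose_smul, Matrix.conjTranspose_one, Matrix.transpose_smul, Matrix.transpose_one, Matrix.smul_mulVec,
    Matrix.one_mulVec, smul_smul, Module.End.one_apply]
  rw [Unitary.mul_star_self_of_mem z.2, one_smul]

/-- generic: if `ρ g = 1` then `ρ^∨ g = 1` on every covector (cf. `Model/SupplyRigidity`'s twin, not imported here). -/
private theorem dual_apply_of_apply_eq_one {k G W : Type*} [CommSemiring k] [Group G] [AddCommMonoid W] [Module k W]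
    (ρ : Representation k G W) {g : G} (h : ρ g = 1) (f : Module.Dual k W) : ρ.dual g f = f := by
  have h' : ρ g⁻¹ = 1 := by rw [← map_one ρ, ← inv_mul_cancel g, map_mul, h, mul_one]
  rw [Representation.dual_apply, h', Module.Dual.transpose_apply]
  exact LinearMap.comp_id f

/-- **`τ₁^∨(z · 1) = id`.** -/
theorem weightOf_dual_blockK_centralK (z : unitary ℂ) (ℓ : Module.Dual ℂ (Fin 2 → ℂ)) :
    (isPullbackCocycle_cotangentCocycle.weightOf x₀).dual (blockK (centralK z)) ℓ = ℓ :=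
  dual_apply_of_apply_eq_one _ (weightOf_blockK_centralK z) ℓ

end CentralK

/-! #### § 3b. The archimedean centre `u_t · 1_V` splits as (`ι₁`-section at `z_t · 1`) · (a factor trivial at `w(ι₁)`) -/

section CenterSplit

variable (L : Type) [Field L] [NumberField L] [IsCMField L] (ι₁ : L →+* ℂ)

/-- the `w(ι₁)`-coordinate of an archimedean relative-norm-one unit `t ∈ U(1)(L⁺ ⊗ ℝ)`. -/
def centerCoord (t : ↥(Literature.NumberTheory.Automorphic.relNormOneInfUnits (↥(maximalRealSubfield L)) L)) : ℂ :=
  UnitaryGroup.evalC L (UnitaryGroup.cmPlace L ι₁)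
    (InfiniteAdeleRing.ringEquiv_mixedSpace L ((t : (InfiniteAdeleRing L)ˣ) : InfiniteAdeleRing L))


-- port_pkg: scope closed for this part
end CenterSplit
end HodgeCM.Model.ArchSideTerm
end
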